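import Summits.ValiantsHypothesis.ValiantsHypothesis.Theses.FifoMatching
import Literature.Combinatorics.Optimization.GridCorCliqueFace
import HarnessLib

/-!
# G♭: the support item `GridCorCliqueFace` (stmt-ValiantsHypothesis-27045) holds

The route `ValiantsHypothesis/FifoMatching` support item #9 `GridCorCliqueFace` (FORM A, crit-3 (β) nod
by name; tenure vw l.1217): for some `c > 0` and all `t ≥ t₀` there is `h ≥ c·t` and a face of the
correlation polytope of the `t × t` grid, `corPolytopeGraph (gridGraph t)`, cut out by finitely many
inequalities valid on all of it, whose image under a linear map is exactly
`corPolytopeGraph ⊤` on `Fin h` (`= COR(K_h)`).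

PROVED: `exact` the Literature theorem
`Literature.Combinatorics.Optimization.AboulkerEtAl2019_gridCorCliqueFace` (`GridCorCliqueFace.lean`,
val-lit-p10 g2), which instantiates the tiling theorem `GridCorTiling.formA_of_blocks`
(`GridCorTiling.lean`, val-lit-p9 g1) with the machine-checked `16 × 16` NAND/XOR crossover block and
the junction block (`GridCorCrossoverBlock.lean`, p10 g2; gates `CorrelationFaceGates.lean`, p10 g2;
grid coordinates `GridCoordinates.lean`, val-lit-p4 g12; faces `CorrelationPolytopeFaces.lean`,
p9 g1).  The construction is Aboulker–Fiorini–Huynh–Macchia–Seif 2019, Theorem 6 (arXiv:1806.00541,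
pp. 5–6) IN PLACE on `COR(G_{t,t})`, with a NAND/XOR crossover instead of the printed
Lichtenstein-derived gadget (same principle: valid inequalities at equality simulate Boolean
constraints).  Constants: `c = 1/32`, `t₀ = 32`, `h = ⌊t/16⌋`.

Consumers (all in the tree): `QueueGridFace.corGridBound_of_gridCorCliqueFace` (hB),
`QueueGridFace.newtXC_of_gridCorCliqueFace` / `nfPolytopeQuasiPolyXC_of_corGridBound'` (K1, item 26254
unconditional), `GridCorShadow.gridCorShadowHard_of_cliqueFace` (shadow line), and Literature-side
`AboulkerEtAl2019_corGridMinor_holds` (the vendored AFHMS fact, discharged).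
Honest frame: a SUPPORT item; VP ≠ VNP is NOT proved; nothing here is a summit statement.
-/

-- Sub = Summit single-conjunct layout: the duplicated namespace component is mandated by the tree.
set_option linter.dupNamespace false

namespace Summit.ValiantsHypothesis.ValiantsHypothesis.Theorems.FifoMatching

/-- **Item stmt-ValiantsHypothesis-27045 `GridCorCliqueFace` — proved** (exact type of the route decl).
[cite: AboulkerEtAl2019, Thm. 6 and its proof (arXiv:1806.00541 pp. 5–6)] -/
theorem gridCorCliqueFace_holds :
    Summit.ValiantsHypothesis.ValiantsHypothesis.Theses.FifoMatching.GridCorCliqueFace :=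
  Literature.Combinatorics.Optimization.AboulkerEtAl2019_gridCorCliqueFace

end Summit.ValiantsHypothesis.ValiantsHypothesis.Theorems.FifoMatching
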